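import Mathlib.MeasureTheory.Integral.IntervalIntegral.IntegrationByParts
import Summits.QuantumFields.BalabanUV.Beta.EriceFlowEnclosureLogScaleAverage

/-!
# Beta / EriceFlowEnclosureLogScaleInclusion — EVERY CESÀRO SCALE LIMIT IS A LOG-SCALE LIMIT (functions at 0⁺): for M continuous on ]0, ∞[ and
# integrable at 0, `∫_h^c M ds∕s = σ(c) − σ(h) + ∫_h^c σ(s) ds∕s` with the Cesàro scale mean `σ(t) = t⁻¹∫₀ᵗ M` (integration by parts), hence
# **`σ → m` at 0⁺ ⟹ `(∫_h^c M ds∕s)∕log(c∕h) → m`** — the continuous twin of P2 #54e `logMean_of_cesaro` and the missing Abelian half of P2 #54j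
# (pure [folklore] SERVICE for rows L122 ∕ L127 ∕ L131–L142; imports P2 #54j and Mathlib's integration by parts).  With row L122 (`letter_iff_cesaro`:
# datum M → m ⟺ σ → m in the letter's class) and P2 #53j (harmonic scale average = cutoff average + o(1)) this closes the square: cutoff ∕ harmonic ∕
# Cesàro-scale limits are ONE notion and imply the log-scale limit, which alone is strictly weaker (P2 #54j `logScaleAverage_escapes`).
#   `hasDerivAt_primitive` (A′ = M on ]0, ∞[ for `A(t) = ∫₀ᵗ M`), `integral_div_eq_parts` (the by-parts identity
#   `∫_h^c M∕s = A(c)∕c − A(h)∕h + ∫_h^c A∕s²`), `cesaroScale_continuousOn`, END **`logScaleAverage_of_cesaroScale`**.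
# (β-flow team, prover 2 = lower ∕ positivity side, unit `b2b-balaban-beta-bflow-p2`, gen 37; module P2 #54k; no Erice sentence occurs)

HONEST FRAMING (page 1 of everything the β sub-cell writes): discharging `BetaPertH` makes Bałaban's UV stability UNCONDITIONAL — a
real constructive-QFT result; it is NOT the continuum limit and NOT the Clay problem.  HONEST DEPENDENCY (cell reorg 2026-08-19,
verbatim): «continuum YM on T⁴ ⇐ BetaPertH ∧ nine spine estimates (0/9 proved); BetaPertH ⇐ (D1) ∧ (D4) ∧ CAP+tail; G-an2-4 gates
asym, D1 and NE2/3/4.»  THIS MODULE DISCHARGES NOTHING and quotes nothing: [folklore] real analysis (Hardy, Divergent Series §3.8, (C,1) ⊂ ℓ,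
continuous form via s ↦ 1∕s).

WHAT THIS FILE PROVES (0 sorry, 0 def): `hasDerivAt_primitive`, `integral_div_eq_parts`, `cesaroScale_continuousOn`, END **`logScaleAverage_of_cesaroScale`**.
NOT CLAIMED: the converse (false in the log-Lipschitz class, P2 #54j; true under power-scale slow decrease, Móricz Cor. 1 — a named fact in the tree);
`BetaPertH`; continuum; Clay.
-/

namespace Summit.QuantumFields.BalabanUV.Beta.EriceFlowEnclosureLogScaleInclusion

open Set Filter Topology MeasureTheory intervalIntegral
open Summit.QuantumFields.BalabanUV.Beta.EriceFlowEnclosureLogScaleAverage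
  (integral_inv_eq_log intervalIntegrable_div_of_continuousOn logScaleAverage_of_tendsto)

noncomputable section

variable {M : ℝ → ℝ} {c : ℝ}

/-- THE PRIMITIVE IS DIFFERENTIABLE: M continuous on ]0, ∞[ and interval integrable on every [0, t] ⟹ `A(t) = ∫₀ᵗ M` has `A′(x) = M(x)` for x > 0.
[folklore] -/
theorem hasDerivAt_primitive (hcont : ContinuousOn M (Ioi 0)) (hint : ∀ t : ℝ, 0 < t → IntervalIntegrable M volume 0 t)
    {x : ℝ} (hx : 0 < x) : HasDerivAt (fun u => ∫ v in (0:ℝ)..u, M v) (M x) x :=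
  integral_hasDerivAt_right (hint x hx) (hcont.stronglyMeasurableAtFilter isOpen_Ioi x hx)
    (hcont.continuousAt (Ioi_mem_nhds hx))

/-- **INTEGRATION BY PARTS**: for 0 < h ≤ c, M continuous on ]0, ∞[ and integrable at 0:
**`∫_h^c M(s)∕s ds = A(c)∕c − A(h)∕h + ∫_h^c A(s)∕s² ds`**, `A(t) = ∫₀ᵗ M` (u = 1∕s, v = A). [folklore] -/
theorem integral_div_eq_parts (hcont : ContinuousOn M (Ioi 0)) (hint : ∀ t : ℝ, 0 < t → IntervalIntegrable M volume 0 t)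
    {h : ℝ} (hh : 0 < h) (hhc : h ≤ c) :
    ∫ s in h..c, M s / s = (∫ v in (0:ℝ)..c, M v) / c - (∫ v in (0:ℝ)..h, M v) / h +
      ∫ s in h..c, (∫ v in (0:ℝ)..s, M v) / s ^ 2 := by
  have hpos : ∀ x ∈ uIcc h c, 0 < x := fun x hx => by rw [uIcc_of_le hhc] at hx; exact hh.trans_le hx.1
  have hu : ∀ x ∈ uIcc h c, HasDerivAt (fun s : ℝ => s⁻¹) (-(x ^ 2)⁻¹) x := fun x hx => hasDerivAt_inv (hpos x hx).ne'
  have hv : ∀ x ∈ uIcc h c, HasDerivAt (fun u => ∫ v in (0:ℝ)..u, M v) (M x) x := fun x hx => hasDerivAt_primitive hcont hint (hpos x hx)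
  have hu' : IntervalIntegrable (fun x : ℝ => -(x ^ 2)⁻¹) volume h c := by
    refine (ContinuousOn.intervalIntegrable ?_)
    rw [uIcc_of_le hhc]
    exact ((continuousOn_pow 2).inv₀ fun x hx => (pow_pos (hh.trans_le hx.1) 2).ne').neg
  have hv' : IntervalIntegrable M volume h c := by
    refine ContinuousOn.intervalIntegrable ?_
    rw [uIcc_of_le hhc]
    exact hcont.mono fun x hx => hh.trans_le hx.1
  have hparts := integral_mul_deriv_eq_deriv_mul hu hv hu' hv'
  -- rewrite the three integrals
  have h1 : ∫ s in h..c, M s / s = ∫ s in h..c, s⁻¹ * M s := integral_congr fun s _ => by rw [div_eq_inv_mul]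
  have h2 : ∫ s in h..c, (∫ v in (0:ℝ)..s, M v) / s ^ 2 = -∫ s in h..c, -(s ^ 2)⁻¹ * ∫ v in (0:ℝ)..s, M v := by
    rw [← intervalIntegral.integral_neg]
    exact integral_congr fun s _ => by rw [div_eq_inv_mul]; ring
  rw [h1, hparts, h2]
  simp only [div_eq_inv_mul]
  ring

/-- The Cesàro scale mean `σ(t) = t⁻¹·∫₀ᵗ M` is continuous on ]0, c] (A is differentiable there). [folklore] -/
theorem cesaroScale_continuousOn (hcont : ContinuousOn M (Ioi 0)) (hint : ∀ t : ℝ, 0 < t → IntervalIntegrable M volume 0 t) :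
    ContinuousOn (fun t => (∫ v in (0:ℝ)..t, M v) / t) (Ioc 0 c) := by
  refine ContinuousOn.div ?_ continuousOn_id fun t ht => ht.1.ne'
  exact fun t ht => (hasDerivAt_primitive hcont hint ht.1).continuousAt.continuousWithinAt

/-- **EVERY CESÀRO SCALE LIMIT IS A LOG-SCALE LIMIT (END).**  M continuous on ]0, ∞[, interval integrable on every [0, t], c > 0, and the Cesàro
scale means `σ(t) = t⁻¹∫₀ᵗ M → m` as t → 0⁺ ⟹ **`(∫_h^c M ds∕s)∕log(c∕h) → m` as h → 0⁺**: by parts the log-scale average of M is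
`(σ(c) − σ(h))∕log(c∕h)` (→ 0) plus the log-scale average of σ (→ m by P2 #54j `logScaleAverage_of_tendsto`).  The converse fails (P2 #54j). [folklore]
(Hardy, Divergent Series §3.8, continuous form) -/
theorem logScaleAverage_of_cesaroScale (hc : 0 < c) (hcont : ContinuousOn M (Ioi 0))
    (hint : ∀ t : ℝ, 0 < t → IntervalIntegrable M volume 0 t) {m : ℝ}
    (hσ : Tendsto (fun t => (∫ v in (0:ℝ)..t, M v) / t) (𝓝[>] 0) (𝓝 m)) :
    Tendsto (fun h => (∫ s in h..c, M s / s) / Real.log (c / h)) (𝓝[>] 0) (𝓝 m) := by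
  have hlog : Tendsto (fun h : ℝ => Real.log (c / h)) (𝓝[>] 0) atTop := by
    have h1 : Tendsto (fun h : ℝ => c / h) (𝓝[>] 0) atTop := Tendsto.const_mul_atTop hc tendsto_inv_nhdsGT_zero
      |>.congr fun h => by rw [div_eq_mul_inv]
    exact Real.tendsto_log_atTop.comp h1
  -- the boundary term
  have hbdry : Tendsto (fun h : ℝ => ((∫ v in (0:ℝ)..c, M v) / c - (∫ v in (0:ℝ)..h, M v) / h) / Real.log (c / h))
      (𝓝[>] 0) (𝓝 0) := (tendsto_const_nhds.sub hσ).div_atTop hlog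
  -- the log-scale average of σ
  have hσc : ContinuousOn (fun t => (∫ v in (0:ℝ)..t, M v) / t) (Ioc 0 c) := cesaroScale_continuousOn hcont hint
  have hmain := logScaleAverage_of_tendsto (M := fun t => (∫ v in (0:ℝ)..t, M v) / t) hc hσc hσ
  have := hbdry.add hmain
  rw [zero_add] at this
  refine this.congr' ?_
  filter_upwards [Ioo_mem_nhdsGT hc] with h hh
  have hh0 : 0 < h := hh.1
  have hhc : h ≤ c := hh.2.le
  rw [integral_div_eq_parts hcont hint hh0 hhc, ← add_div]
  congr 2
  refine integral_congr fun s _ => ?_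
  rw [div_div, ← pow_two]

end

end Summit.QuantumFields.BalabanUV.Beta.EriceFlowEnclosureLogScaleInclusion
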